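import Literature.Computability.Complexity.UniversalNEXPVerifier
import Literature.Computability.Complexity.NTIMEWindow
import HarnessLib

/-!
# A universal language for `NTIME(2ⁿ)` inside `NEXP`, from a clocked universal machine

Literature / complexity toolkit; completes the derivation of the machine `U` of
Impagliazzo–Kabanets–Wigderson's proof of their Lemma 5 ("on input `(i, x)` … runs in time
`2^{2n}`, simulating the `i`th nondeterministic Turing machine `Mᵢ` on input `x`; `U` accepts iff
`Mᵢ` accepts") from the tree's universal-machine fact
`Literature.Computability.MetaComplexity.UniversalMachine.clockedUniversalSimulation`
(Arora–Barak Thm. 1.9, clocked; a named fact of `UniversalMachineProofs.lean`):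

* `eventually_eval_mul_two_pow_pow_le` — thresholds: `p(a·2^{m^k}) ≤ 2^{m^{k+1}}` for all large
  `m` (the machine-dependent polynomial overhead of the simulation is absorbed by one more power
  in the exponent);
* **`exists_NEXP_universal_of_clockedUniversalSimulation`** — given a clocked interpreter `run`
  (monotone in the budget, polynomial-time as a function of `(prog, 1ᵗ)`, simulating every TM2
  machine with polynomial overhead), the language
  `K = {⟨e, x⟩ | ∃ y, |y| ≤ 2^{m²}+1 ∧ run ⟨e, ⟨x, y⟩⟩ (2^{m³}+1) = some [1]}` of
  `UniversalNEXPVerifier.lean` is in `NEXP` (`exists_univLang_mem_NTIME`, exponent `4`) and is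
  universal for `NTIME(2ⁿ)`: for `L' ∈ NTIME(2ⁿ)` take the TOTAL verifier `V'` of
  `exists_total_verifier_of_mem_NTIME_two_pow` (`NTIMEWindow.lean`) and its simulation code `e`;
  then `x ∈ L' ↔ ⟨e, x⟩ ∈ K` for all long `x` — completeness: an admissible witness of `V'` is
  inside the window `2^{m²}+1` and the simulation of `V'` fits the budget `2^{m³}+1`, so
  `run_mono` transports the accepting answer; soundness: whatever `y` in the window the
  universal verifier accepts with, the simulation of `V'` on `⟨x, y⟩` also fits the budget, so by
  determinism (`run_mono` again) the answer is `V'`'s, and `V'` is sound for every witness.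

The statement proved is literally that of the named fact `exists_NEXP_universal_for_NTIME_two_pow`
(`EasyWitnessUniversal.lean`), so that IKW's Lemma 5, and with it the easy-witness decomposition
of `NEXP ⊆ P/poly ⟹ NEXP = EXP`, rest on `clockedUniversalSimulation` in place of that fact.

## References

* S. Arora, B. Barak, *Computational Complexity: A Modern Approach*, CUP 2009, Thm. 1.9 and
  §1.4.1 (clocked efficient universal machine), §2.1.2 / Exercise 2.6 (universal NDTM).
* R. Impagliazzo, V. Kabanets, A. Wigderson, *In search of an easy witness*, JCSS 65 (2002),
  proof of Lemma 5.
-/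

namespace Literature.Computability.Complexity

open _root_.Computability Turing Polynomial Filter

/-- **Thresholds**: for every polynomial `p` and constants `a, k`, `p(a·2^{m^k}) ≤ 2^{m^{k+1}}` for
all sufficiently large `m` (indeed for `m ≥ p(1)(a+1)^{deg p} + deg p + 1`). [folklore] -/
theorem eventually_eval_mul_two_pow_pow_le (p : Polynomial ℕ) (a k : ℕ) :
    ∀ᶠ m in atTop, p.eval (a * 2 ^ (m ^ k)) ≤ 2 ^ (m ^ (k + 1)) := by
  refine eventually_atTop.2
    ⟨p.eval 1 * (a + 1) ^ p.natDegree + p.natDegree + 1, fun m hm => ?_⟩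
  have hm1 : 1 ≤ m := by omega
  have h1 : p.eval (a * 2 ^ (m ^ k)) ≤ p.eval ((a + 1) * 2 ^ (m ^ k)) :=
    natPoly_eval_mono _ (Nat.mul_le_mul_right _ (Nat.le_succ a))
  have h2 : p.eval ((a + 1) * 2 ^ (m ^ k)) ≤
      p.eval 1 * (a + 1) ^ p.natDegree * (2 ^ (m ^ k)) ^ p.natDegree := by
    have h := natPoly_eval_le_eval_one_mul_pow p (n := (a + 1) * 2 ^ (m ^ k))
      (Nat.succ_le_of_lt (by positivity))
    rwa [mul_pow, ← mul_assoc] at h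
  have h3 : p.eval 1 * (a + 1) ^ p.natDegree * (2 ^ (m ^ k)) ^ p.natDegree ≤
      2 ^ (p.eval 1 * (a + 1) ^ p.natDegree + p.natDegree * m ^ k) := by
    rw [← pow_mul, mul_comm (m ^ k) p.natDegree, pow_add]
    exact Nat.mul_le_mul_right _ Nat.lt_two_pow_self.le
  have h4 : p.eval 1 * (a + 1) ^ p.natDegree + p.natDegree * m ^ k ≤ m ^ (k + 1) := by
    have hmk : 1 ≤ m ^ k := Nat.one_le_pow _ _ hm1
    calc p.eval 1 * (a + 1) ^ p.natDegree + p.natDegree * m ^ k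
        ≤ p.eval 1 * (a + 1) ^ p.natDegree * m ^ k + p.natDegree * m ^ k :=
          Nat.add_le_add_right (Nat.le_mul_of_pos_right _ hmk) _
      _ = (p.eval 1 * (a + 1) ^ p.natDegree + p.natDegree) * m ^ k := by ring
      _ ≤ m * m ^ k := Nat.mul_le_mul_right _ (by omega)
      _ = m ^ (k + 1) := by ring
  exact h1.trans (h2.trans (h3.trans (Nat.pow_le_pow_right (by norm_num) h4)))

/-- `[b] = [true] ↔ b = true` for the one-symbol answer code. [folklore] -/
theorem encodeBool_eq_singleton_true_iff (b : Bool) : encodeBool b = [true] ↔ b = true := by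
  cases b <;> simp [encodeBool]

/-- **A universal language for `NTIME(2ⁿ)` inside `NEXP`, from a clocked universal machine**
(IKW, proof of Lemma 5; Arora–Barak §2.1.2 / Exercise 2.6 with Thm. 1.9): under
`clockedUniversalSimulation` there is `K ∈ NEXP` such that every `L' ∈ NTIME(2ⁿ)` satisfies
`x ∈ L' ↔ ⟨e, x⟩ ∈ K` for a code `e` and all sufficiently long `x`. `K` is the language of
`exists_univLang_mem_NTIME` (window `2^{m²}+1`, budget `2^{m³}+1`, in `NTIME(2^{m⁴})`); `e` is the
simulation code of the total verifier of `L'` (`exists_total_verifier_of_mem_NTIME_two_pow`); the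
thresholds are those of `eventually_eval_mul_two_pow_pow_le`. This is the statement of the named
fact `exists_NEXP_universal_for_NTIME_two_pow` of `EasyWitnessUniversal.lean`.
[cite: ImpagliazzoKabanetsWigderson2002, Lemma 5 (proof)] [cite: AroraBarakCC2009, §2.1.2 and Exercise 2.6] -/
theorem exists_NEXP_universal_of_clockedUniversalSimulation
    (hU : MetaComplexity.UniversalMachine.clockedUniversalSimulation) :
    ∃ K ∈ NEXP, ∀ L' ∈ NTIME (fun n => 2 ^ n), ∃ e : List Bool,
      ∀ᶠ n in atTop, ∀ x : List Bool, x.length = n → (x ∈ L' ↔ boolPair e x ∈ K) := by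
  obtain ⟨run, hmono, hpoly, hsim⟩ := hU
  obtain ⟨pU, MU, hMU⟩ := hpoly
  obtain ⟨K, hK, hKiff⟩ := exists_univLang_mem_NTIME run (pU := pU) (MU := MU)
    (fun prog t => hMU (prog, t))
  refine ⟨K, Set.mem_iUnion.2 ⟨4, hK⟩, fun L' hL' => ?_⟩
  obtain ⟨C', R', V', hVt, hViff, hVsound⟩ := exists_total_verifier_of_mem_NTIME_two_pow hL'
  obtain ⟨e, p, hep⟩ := hsim V'
  refine ⟨e, ?_⟩
  -- thresholds (in `n`, resp. in `m = 2|e| + 2 + n`)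
  have E1 := eventually_eval_mul_two_pow_pow_le (X : Polynomial ℕ) (2 * C') 1
  have E2 := eventually_eval_mul_two_pow_pow_le p (4 * C') 1
  obtain ⟨M₃, hM₃⟩ := eventually_atTop.1 (eventually_eval_mul_two_pow_pow_le p (2 * C' + 2) 2)
  filter_upwards [E1, E2, eventually_ge_atTop M₃] with n hn1 hn2 hn3 x hx
  simp only [eval_X, pow_one, Nat.reduceAdd] at hn1 hn2
  rw [hKiff]
  simp only [boolUnpair_boolPair, length_boolPair]
  -- the lengths involved
  set m := 2 * e.length + 2 + x.length with hm
  have hnm : x.length ≤ m := by omega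
  have hm1 : 1 ≤ m := by omega
  have hE3 : p.eval ((2 * C' + 2) * 2 ^ (m ^ 2)) ≤ 2 ^ (m ^ 3) := hM₃ m (by omega)
  have h2n : 2 ^ x.length ≤ 2 ^ (m ^ 2) :=
    Nat.pow_le_pow_right (by norm_num) (hnm.trans (by nlinarith))
  have hn22 : 2 ^ (x.length ^ 2) ≤ 2 ^ (m ^ 2) :=
    Nat.pow_le_pow_right (by norm_num) (Nat.pow_le_pow_left hnm 2)
  have hm23 : 2 ^ (m ^ 2) ≤ 2 ^ (m ^ 3) := two_pow_pow_mono (by norm_num) (by norm_num)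
  rw [hx] at h2n hn22
  have hc0 : C' ≤ C' * 2 ^ n := Nat.le_mul_of_pos_right _ (by positivity)
  have e21 : 2 * C' * 2 ^ n = 2 * (C' * 2 ^ n) := by ring
  have e41 : 4 * C' * 2 ^ n = 4 * (C' * 2 ^ n) := by ring
  constructor
  · -- completeness: an admissible witness of `V'` is accepted inside window and budget
    intro hxL
    obtain ⟨y, hy, hR⟩ := (hViff x).1 hxL
    rw [hx] at hy
    refine ⟨y, by omega, ?_⟩
    have hv := hVt x y
    rw [hR, hx] at hv
    have h1 := hep _ _ _ hv
    have hbudget : p.eval (C' * 2 ^ n + C' + y.length) ≤ 2 ^ (m ^ 3) + 1 :=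
      (natPoly_eval_mono p (by omega : C' * 2 ^ n + C' + y.length ≤ 4 * C' * 2 ^ n)).trans
        (by omega)
    have h2 := hmono hbudget h1
    rw [h2]
    rfl
  · -- soundness: the accepting answer in the budget is `V'`'s answer, sound for every witness
    rintro ⟨y, hy, hrun⟩
    have hv := hVt x y
    rw [hx] at hv
    have h1 := hep _ _ _ hv
    have harg : C' * 2 ^ n + C' + y.length ≤ (2 * C' + 2) * 2 ^ (m ^ 2) := by
      have e2 : (2 * C' + 2) * 2 ^ (m ^ 2) = 2 * (C' * 2 ^ (m ^ 2)) + 2 * 2 ^ (m ^ 2) := by ring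
      have hc : C' * 2 ^ n ≤ C' * 2 ^ (m ^ 2) := Nat.mul_le_mul_left _ h2n
      have hc1 : C' ≤ C' * 2 ^ (m ^ 2) := Nat.le_mul_of_pos_right _ (by positivity)
      have hi : 1 ≤ 2 ^ (m ^ 2) := Nat.one_le_two_pow
      omega
    have hbudget : p.eval (C' * 2 ^ n + C' + y.length) ≤ 2 ^ (m ^ 3) + 1 :=
      ((natPoly_eval_mono p harg).trans hE3).trans (Nat.le_succ _)
    have h2 := hmono hbudget h1
    rw [hrun] at h2
    have hRtrue : R' x y = true := by
      have h3 : encodeBool (R' x y) = [true] := (Option.some.inj h2).symm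
      exact (encodeBool_eq_singleton_true_iff _).1 h3
    exact hVsound x y hRtrue

end Literature.Computability.Complexity
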